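import Mathlib.LinearAlgebra.Matrix.Reindex
import Summits.ValiantsHypothesis.ValiantsHypothesis.Theorems.LiftNullstellensatzLiftWidthPerFourDefectChartD

/-!
# Route LiftNullstellensatz — `LiftWidthPerFour` (item stmt-ValiantsHypothesis-5922): Claim F,
the defect chart in arbitrary position

`echelon_family_row_vanishes`: if a space `W` of `4 × 4` matrices with vanishing permanent
contains, for every cell `c` with row `≠ i'` other than one cell `(a, b)` (`a ≠ i'`), a matrix
`B_c` with `B_c(c) = 1` and `B_c(c') = 0` at the other such cells, then every `B_c` has zero
row `i'`.  Proof: relabel rows and columns (`a ↦ 0`, `i' ↦ 3`, `b ↦ 0`; the permanent is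
invariant) and apply `defect_chart_lam_eq_zero`.  No new definitions.
-/

namespace Summit.ValiantsHypothesis.LiftNullstellensatz

open Matrix

/-- The permanent is invariant under reindexing rows and columns by permutations. [folklore] -/
theorem permanent_reindex_perm {K : Type*} [CommRing K] {n : Type*} [Fintype n] [DecidableEq n]
    (σ τ : Equiv.Perm n) (M : Matrix n n K) : (Matrix.reindex σ τ M).permanent = M.permanent := by
  rw [Matrix.reindex_apply]
  have : M.submatrix (σ.symm : n → n) (τ.symm : n → n) =
      (M.submatrix (σ.symm : n → n) id).submatrix id (τ.symm : n → n) := by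
    ext i j; rfl
  rw [this, Matrix.permanent_permute_rows, Matrix.permanent_permute_cols]

/-- **Claim F, defect chart in arbitrary position**: see the module docstring.
[cite: GutermanMeshulamSpiridonov2023, Prop. 3.1 (method)] -/
theorem echelon_family_row_vanishes {K : Type*} [Field K] (h2 : (2 : K) ≠ 0)
    (W : Submodule K (Matrix (Fin 4) (Fin 4) K)) (hper : ∀ A ∈ W, A.permanent = 0)
    (i' a b : Fin 4) (hai : a ≠ i') (B : Fin 4 → Fin 4 → Matrix (Fin 4) (Fin 4) K)
    (hBW : ∀ r s, r ≠ i' → (r, s) ≠ (a, b) → B r s ∈ W)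
    (hB1 : ∀ r s, r ≠ i' → (r, s) ≠ (a, b) → B r s r s = 1)
    (hB0 : ∀ r s, r ≠ i' → (r, s) ≠ (a, b) → ∀ r' s', r' ≠ i' → (r', s') ≠ (a, b) →
      (r', s') ≠ (r, s) → B r s r' s' = 0) :
    ∀ r s, r ≠ i' → (r, s) ≠ (a, b) → ∀ t, B r s i' t = 0 := by
  classical
  -- relabelling permutations
  set σ₁ : Equiv.Perm (Fin 4) := Equiv.swap a 0 with hσ₁
  have hσ₁a : σ₁ a = 0 := by simp [hσ₁]
  have hσ₁i : σ₁ i' ≠ 0 := by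
    intro h
    have : σ₁ i' = σ₁ a := by rw [h, hσ₁a]
    exact hai (σ₁.injective this).symm
  set σ : Equiv.Perm (Fin 4) := σ₁.trans (Equiv.swap (σ₁ i') 3) with hσ
  have hσa : σ a = 0 := by
    simp only [hσ, Equiv.trans_apply, hσ₁a]
    exact Equiv.swap_apply_of_ne_of_ne hσ₁i.symm (by decide)
  have hσi : σ i' = 3 := by simp [hσ]
  set τ : Equiv.Perm (Fin 4) := Equiv.swap b 0 with hτ
  have hτb : τ b = 0 := by simp [hτ]
  -- the relabelled space
  let e : Matrix (Fin 4) (Fin 4) K ≃ₗ[K] Matrix (Fin 4) (Fin 4) K := Matrix.reindexLinearEquiv K K σ τ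
  set W' : Submodule K (Matrix (Fin 4) (Fin 4) K) := W.map (e : Matrix (Fin 4) (Fin 4) K →ₗ[K] _)
    with hW'
  have hper' : ∀ A ∈ W', A.permanent = 0 := by
    intro A hA
    obtain ⟨M, hM, rfl⟩ := Submodule.mem_map.1 hA
    show (Matrix.reindex σ τ M).permanent = 0
    rw [permanent_reindex_perm]
    exact hper M hM
  -- the defect-chart data
  let μ : Fin 4 → Fin 4 → K := fun i j => B (σ.symm i) (τ.symm j) a b
  let lam : Fin 4 → Fin 4 → Fin 4 → K := fun i j ℓ => B (σ.symm i) (τ.symm j) i' (τ.symm ℓ)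
  have hcell : ∀ i j : Fin 4, i ≠ 3 → (i, j) ≠ (0, 0) →
      σ.symm i ≠ i' ∧ (σ.symm i, τ.symm j) ≠ (a, b) := by
    intro i j hi hij
    refine ⟨fun h => hi ?_, fun h => hij ?_⟩
    · rw [← hσi, ← h, Equiv.apply_symm_apply]
    · obtain ⟨h1, h2'⟩ := Prod.mk.inj h
      have e1 : i = 0 := by rw [← hσa, ← h1, Equiv.apply_symm_apply]
      have e2 : j = 0 := by rw [← hτb, ← h2', Equiv.apply_symm_apply]
      rw [e1, e2]
  have hA : ∀ i j : Fin 4, i ≠ 3 → (i, j) ≠ (0, 0) →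
      (Matrix.of fun r s : Fin 4 => if r = 3 then lam i j s else
        ((if r = i then (if s = j then (1 : K) else 0) else 0) +
         (if r = 0 then (if s = 0 then μ i j else 0) else 0))) ∈ W' := by
    intro i j hi hij
    obtain ⟨hp, hpq⟩ := hcell i j hi hij
    have hmem : e (B (σ.symm i) (τ.symm j)) ∈ W' := Submodule.mem_map_of_mem (hBW _ _ hp hpq)
    convert hmem using 1
    ext r s
    simp only [Matrix.of_apply]
    show _ = (Matrix.reindex σ τ (B (σ.symm i) (τ.symm j))) r s
    rw [Matrix.reindex_apply, Matrix.submatrix_apply]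
    by_cases hr : r = 3
    · subst hr
      rw [if_pos rfl]
      show B (σ.symm i) (τ.symm j) i' (τ.symm s) = _
      congr 1
      rw [← hσi, Equiv.symm_apply_apply]
    · rw [if_neg hr]
      by_cases hrs : (r, s) = (0, 0)
      · obtain ⟨rfl, rfl⟩ := Prod.mk.inj hrs
        have hi0 : ¬ (i = 0 ∧ j = 0) := fun h => hij (by rw [h.1, h.2])
        have hσ0 : σ.symm 0 = a := by rw [← hσa, Equiv.symm_apply_apply]
        have hτ0 : τ.symm 0 = b := by rw [← hτb, Equiv.symm_apply_apply]
        rw [hσ0, hτ0, if_pos rfl, if_pos rfl]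
        by_cases hi0' : (0 : Fin 4) = i
        · subst hi0'
          rw [if_pos rfl, if_neg (fun h => hi0 ⟨rfl, h.symm⟩), zero_add]
        · rw [if_neg hi0', zero_add]
      · -- an ordinary cell: B there is δ
        obtain ⟨hp', hpq'⟩ := hcell r s hr hrs
        have hz : (if r = 0 then (if s = 0 then μ i j else 0) else (0 : K)) = 0 := by
          by_cases h0 : r = 0
          · subst h0
            rw [if_pos rfl, if_neg]
            intro hs; exact hrs (by rw [hs])
          · rw [if_neg h0]
        rw [hz, add_zero]
        by_cases hri : r = i
        · subst hri
          rw [if_pos rfl]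
          by_cases hsj : s = j
          · subst hsj; rw [if_pos rfl, hB1 _ _ hp' hpq']
          · rw [if_neg hsj, hB0 _ _ hp hpq _ _ hp' hpq']
            intro h
            exact hsj (τ.symm.injective (Prod.mk.inj h).2)
        · rw [if_neg hri, hB0 _ _ hp hpq _ _ hp' hpq']
          intro h
          exact hri (σ.symm.injective (Prod.mk.inj h).1)
  have key := defect_chart_lam_eq_zero h2 μ lam W' hA hper'
  intro r s hr hrs t
  have h1 : σ r ≠ 3 := fun h => hr (σ.injective (h.trans hσi.symm))
  have h2' : (σ r, τ s) ≠ (0, 0) := by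
    intro h
    obtain ⟨hr0, hs0⟩ := Prod.mk.inj h
    exact hrs (by rw [σ.injective (hr0.trans hσa.symm), τ.injective (hs0.trans hτb.symm)])
  have := key (σ r) (τ s) h1 h2' (τ t)
  simpa [lam, Equiv.symm_apply_apply] using this

end Summit.ValiantsHypothesis.LiftNullstellensatz
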